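import Summits.Ventures.HodgeRepro2.A2HardLefschetzOps

/-!
# A2 annex — HARD LEFSCHETZ IN THE TWELVE-PLANE MODEL: `L^{|ι|−k} : ⋀^k → ⋀^{2|ι|−k}` is bijective for every `θ = Σ_p c_p E_p` with all `c_p ≠ 0`

Cell pub-hodge-repro2, seat p6 (Tier-4 sub-claim A2). Paragraph (A9) of route/T4-A2-p6.md uses
Voisin's Theorem 6.25 (*Hodge Theory and Complex Algebraic Geometry I*, held copy p0125 l. 37 –
p0126 l. 3, the section's E40 — hard Lefschetz for the Kähler class of the abelian variety `B`) as
DATA (row 75 of route/LEAN-ANNEX-p6.md, the structure `HardLefschetz D θ`). In p5's exterior-algebra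
model of `H^*(B, ℂ)` this file PROVES the statement, for EVERY class `θ = Σ_p c_p E_p` with all
`c_p ≠ 0` (the Kähler classes are the special case of (A4.2.7)'s θ_i with real coefficients of one
sign; rows 78–80), by the sl₂-style argument of the flat Kähler identities:

* `lam_lef_pow` — the commutator with a power, `Λ L^{m+1} v = L^{m+1} Λ v + (m+1)(|ι| − k − m) L^m v`
  for `v ∈ ⋀^k`, from the one-step identity `[Λ, L] = |ι| − k` of `A2HardLefschetzOps`;
* `eq_zero_of_lam_eq_zero_of_lef_pow_eq_zero` — a PRIMITIVE vector (`Λ v = 0`) of degree `k` with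
  `L^m v = 0` and `k + m ≤ |ι|` is zero (the coefficients `(m'+1)(|ι| − k − m')` are non-zero);
* `eq_zero_of_lef_pow_eq_zero` — INJECTIVITY: `L^m` is injective on `⋀^k` whenever `k + m ≤ |ι|`
  (strong induction on `k`: `Λ v` is of degree `k − 2` and killed by `L^{m+1}`, so `Λ v = 0`, so `v`
  is primitive);
* `lefPow` — `L^m` restricted to a linear map `⋀^k → ⋀^{k+2m}`; `finrank_grading` — `dim ⋀^k = C(2|ι|, k)`
  (Mathlib's `exteriorPower.finrank_eq`);
* **`hardLefschetz_bijective`** — for `k ≤ |ι|`, `L^{|ι|−k} : ⋀^k → ⋀^{2|ι|−k}` is bijective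
  (injective + equal dimensions, `C(2|ι|, k) = C(2|ι|, 2|ι| − k)`);
* **`hardLefschetz_bijOn`** — the same as `Set.BijOn (θ^{|ι|−k} * ·) (⋀^k) (⋀^{2|ι|−k})`, the shape of
  row 75's datum; `lefschetzEquiv` — the linear equivalence, whose inverse is (A9)'s `(L^{|ι|−k})^{-1}`;
* `lefschetz_surjective_of_le` — the corollary «`L : ⋀^d → ⋀^{d+2}` is onto for `2d + 2 ≥ 2|ι|`».

Everything is algebra of the model (the identification `H^*(B, ℂ) = ⋀^* H^1(B, ℂ)` with cup product =
wedge is A0.3 (ii) of the prose, and θ = the Kähler class is (A4.2.7)); nothing about varieties is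
asserted. The twelve-plane numbers (`|ι| = 12`, `k = 4`, `L^8 : ⋀^4 → ⋀^{20}`) are in
`A2HardLefschetzTwelve`.
-/

namespace Summit.Ventures.HodgeRepro2.A2HardLefschetzMain

open WeilPlanes WeilIntegral WeilCoproduct A2HardLefschetzOps

variable {ι : Type*} [DecidableEq ι] [Fintype ι]

/-- The one-step commutator, solved for `Λ L v`: `Λ (L v) = L (Λ v) + (|ι| − k) • v` on `⋀^k`. -/
theorem lam_lef {c : ι → ℂ} (hc : ∀ p, c p ≠ 0) {k : ℕ} {v : A ι} (hv : v ∈ grading ι k) :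
    lam c (lef c v) = lef c (lam c v) + ((Fintype.card ι : ℂ) - k) • v := by
  rw [← lam_lef_sub_lef_lam hc hv]
  abel

/-- THE COMMUTATOR WITH A POWER: for `v ∈ ⋀^k`,
`Λ L^{m+1} v = L^{m+1} Λ v + (m+1)(|ι| − k − m) • L^m v`. -/
theorem lam_lef_pow {c : ι → ℂ} (hc : ∀ p, c p ≠ 0) {k : ℕ} {v : A ι} (hv : v ∈ grading ι k)
    (m : ℕ) :
    lam c ((lef c ^ (m + 1)) v) = (lef c ^ (m + 1)) (lam c v) +
      (((m : ℂ) + 1) * ((Fintype.card ι : ℂ) - k - m)) • (lef c ^ m) v := by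
  induction m with
  | zero =>
    rw [pow_one, pow_zero, Module.End.one_apply, lam_lef hc hv]
    congr 1
    congr 1
    push_cast
    ring
  | succ m ih =>
    have hw : (lef c ^ (m + 1)) v ∈ grading ι (k + 2 * (m + 1)) := lef_pow_mem_grading c _ hv
    rw [pow_succ' (lef c) (m + 1), Module.End.mul_apply, lam_lef hc hw, ih, map_add, map_smul,
      ← Module.End.mul_apply (lef c) (lef c ^ (m + 1)), ← pow_succ',
      ← Module.End.mul_apply (lef c) (lef c ^ m), ← pow_succ', add_assoc, ← add_smul]
    congr 2
    push_cast
    ring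

/-- A PRIMITIVE vector killed by a Lefschetz power below the middle is zero: `v ∈ ⋀^k`, `Λ v = 0`,
`k + m ≤ |ι|`, `L^m v = 0` ⇒ `v = 0`. -/
theorem eq_zero_of_lam_eq_zero_of_lef_pow_eq_zero {c : ι → ℂ} (hc : ∀ p, c p ≠ 0) {k : ℕ}
    {v : A ι} (hv : v ∈ grading ι k) (hΛ : lam c v = 0) {m : ℕ} (hm : k + m ≤ Fintype.card ι)
    (h : (lef c ^ m) v = 0) : v = 0 := by
  induction m with
  | zero => simpa using h
  | succ m ih =>
    have h1 := lam_lef_pow hc hv m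
    rw [h, map_zero, hΛ, map_zero, zero_add] at h1
    have hne : ((m : ℂ) + 1) * ((Fintype.card ι : ℂ) - k - m) ≠ 0 := by
      refine mul_ne_zero (Nat.cast_add_one_ne_zero m) ?_
      have : ((Fintype.card ι : ℂ) - k - m) = ((Fintype.card ι - (k + m) : ℕ) : ℂ) := by
        rw [Nat.cast_sub (by omega)]
        push_cast
        ring
      rw [this]
      exact Nat.cast_ne_zero.mpr (by omega)
    exact ih (by omega) ((smul_eq_zero.mp h1.symm).resolve_left hne)

/-- INJECTIVITY OF THE LEFSCHETZ POWERS BELOW THE MIDDLE: for `v ∈ ⋀^k` and `k + m ≤ |ι|`,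
`L^m v = 0 ⇒ v = 0`. -/
theorem eq_zero_of_lef_pow_eq_zero {c : ι → ℂ} (hc : ∀ p, c p ≠ 0) {k : ℕ} {v : A ι}
    (hv : v ∈ grading ι k) {m : ℕ} (hm : k + m ≤ Fintype.card ι) (h : (lef c ^ m) v = 0) :
    v = 0 := by
  induction k using Nat.strong_induction_on generalizing v m with
  | _ k ih =>
    have h1 : (lef c ^ (m + 1)) v = 0 := by
      rw [pow_succ', Module.End.mul_apply, h, map_zero]
    have h2 := lam_lef_pow hc hv m
    rw [h1, map_zero, h, smul_zero, add_zero] at h2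
    have hΛ : lam c v = 0 := by
      rcases lt_or_ge k 2 with hk | hk
      · exact lam_eq_zero_of_mem_lt_two c hk hv
      · obtain ⟨k', rfl⟩ : ∃ k', k = k' + 2 := ⟨k - 2, by omega⟩
        exact ih k' (by omega) (lam_mem_grading c hv) (by omega) h2.symm
    exact eq_zero_of_lam_eq_zero_of_lef_pow_eq_zero hc hv hΛ hm h

/-- `L^m` restricted to a linear map `⋀^k → ⋀^{k+2m}`. -/
noncomputable def lefPow (c : ι → ℂ) (k m : ℕ) : grading ι k →ₗ[ℂ] grading ι (k + 2 * m) :=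
  (lef c ^ m).restrict fun _ hx => lef_pow_mem_grading c m hx

/-- The restricted power acts as `L^m` on the underlying element. -/
@[simp] theorem lefPow_apply_coe (c : ι → ℂ) (k m : ℕ) (x : grading ι k) :
    (lefPow c k m x : A ι) = (lef c ^ m) x := rfl

/-- `L^m : ⋀^k → ⋀^{k+2m}` is injective for `k + m ≤ |ι|`. -/
theorem lefPow_injective {c : ι → ℂ} (hc : ∀ p, c p ≠ 0) {k m : ℕ}
    (hm : k + m ≤ Fintype.card ι) : Function.Injective (lefPow c k m) := by
  rw [injective_iff_map_eq_zero]
  intro x hx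
  apply Subtype.ext
  exact eq_zero_of_lef_pow_eq_zero hc x.2 hm (congrArg Subtype.val hx)

omit [DecidableEq ι] in
/-- `dim V ι = 2|ι|`. -/
theorem finrank_V : Module.finrank ℂ (V ι) = 2 * Fintype.card ι := by
  rw [Module.finrank_fintype_fun_eq_card, Fintype.card_prod, Fintype.card_bool, mul_comm]

/-- `dim ⋀^k = C(2|ι|, k)`. -/
theorem finrank_grading (k : ℕ) :
    Module.finrank ℂ (grading ι k) = (2 * Fintype.card ι).choose k := by
  rw [grading, exteriorPower.finrank_eq, finrank_V]

/-- The graded pieces are finite-dimensional. -/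
instance finiteDimensional_grading (k : ℕ) : FiniteDimensional ℂ (grading ι k) :=
  exteriorPower.instFinite

/-- HARD LEFSCHETZ IN THE MODEL: for `k ≤ |ι|` and every `θ = Σ_p c_p E_p` with all `c_p ≠ 0`,
`L^{|ι|−k} : ⋀^k → ⋀^{2|ι|−k}` is bijective. (Voisin, Theorem 6.25, for the model, for all
non-zero coefficient vectors.) -/
theorem hardLefschetz_bijective {c : ι → ℂ} (hc : ∀ p, c p ≠ 0) {k : ℕ}
    (hk : k ≤ Fintype.card ι) : Function.Bijective (lefPow c k (Fintype.card ι - k)) := by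
  have hinj : Function.Injective (lefPow c k (Fintype.card ι - k)) :=
    lefPow_injective hc (by omega)
  refine ⟨hinj, ?_⟩
  rw [← LinearMap.injective_iff_surjective_of_finrank_eq_finrank]
  · exact hinj
  · rw [finrank_grading, finrank_grading, show k + 2 * (Fintype.card ι - k) =
      2 * Fintype.card ι - k by omega, Nat.choose_symm (by omega)]

/-- The Lefschetz isomorphism `⋀^k ≃ ⋀^{k+2(|ι|−k)}` of hard Lefschetz; its inverse is (A9)'s
`(L^{|ι|−k})^{-1}`. -/
noncomputable def lefschetzEquiv (c : ι → ℂ) (hc : ∀ p, c p ≠ 0) (k : ℕ)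
    (hk : k ≤ Fintype.card ι) :
    grading ι k ≃ₗ[ℂ] grading ι (k + 2 * (Fintype.card ι - k)) :=
  LinearEquiv.ofBijective _ (hardLefschetz_bijective hc hk)

/-- The Lefschetz isomorphism acts as `θ^{|ι|−k} ∧ ·`. -/
theorem lefschetzEquiv_apply_coe (c : ι → ℂ) (hc : ∀ p, c p ≠ 0) (k : ℕ)
    (hk : k ≤ Fintype.card ι) (x : grading ι k) :
    (lefschetzEquiv c hc k hk x : A ι) = theta c ^ (Fintype.card ι - k) * x := by
  change ((lef c ^ (Fintype.card ι - k)) x : A ι) = _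
  rw [lef, LinearMap.pow_mulLeft, LinearMap.mulLeft_apply]

/-- HARD LEFSCHETZ AS A `Set.BijOn` (the shape of row 75's datum `HardLefschetz D θ`):
`θ^{|ι|−k} ∧ ·` maps `⋀^k` bijectively onto `⋀^{2|ι|−k}`. -/
theorem hardLefschetz_bijOn {c : ι → ℂ} (hc : ∀ p, c p ≠ 0) {k : ℕ} (hk : k ≤ Fintype.card ι) :
    Set.BijOn (fun x => theta c ^ (Fintype.card ι - k) * x) (grading ι k : Set (A ι))
      (grading ι (2 * Fintype.card ι - k) : Set (A ι)) := by
  have hdeg : k + 2 * (Fintype.card ι - k) = 2 * Fintype.card ι - k := by omega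
  have hpow : ∀ x : A ι, theta c ^ (Fintype.card ι - k) * x = (lef c ^ (Fintype.card ι - k)) x := by
    intro x
    rw [lef, LinearMap.pow_mulLeft, LinearMap.mulLeft_apply]
  obtain ⟨hinj, hsurj⟩ := hardLefschetz_bijective hc hk
  refine ⟨fun x hx => ?_, fun x hx y hy hxy => ?_, fun y hy => ?_⟩
  · dsimp only
    rw [SetLike.mem_coe, hpow, ← hdeg]
    exact lef_pow_mem_grading c _ hx
  · dsimp only at hxy
    have := @hinj ⟨x, hx⟩ ⟨y, hy⟩ (Subtype.ext (by simpa [hpow] using hxy))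
    exact congrArg Subtype.val this
  · rw [SetLike.mem_coe, ← hdeg] at hy
    obtain ⟨x, hx⟩ := hsurj ⟨y, hy⟩
    exact ⟨x, x.2, by dsimp only; rw [hpow]; exact congrArg Subtype.val hx⟩

/-- The consequence above the middle: `L = θ ∧ · : ⋀^d → ⋀^{d+2}` is ONTO whenever `|ι| ≤ d + 1`
(it is the last factor of the bijective `L^{|ι|−(2|ι|−d−2)} : ⋀^{2|ι|−d−2} → ⋀^{d+2}`). -/
theorem lef_surjOn_of_le {c : ι → ℂ} (hc : ∀ p, c p ≠ 0) {d : ℕ} (hd : Fintype.card ι ≤ d + 1)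
    (hd' : d + 2 ≤ 2 * Fintype.card ι) :
    Set.SurjOn (fun x => theta c * x) (grading ι d : Set (A ι))
      (grading ι (d + 2) : Set (A ι)) := by
  intro y hy
  -- the source degree of the bijective power landing in `⋀^{d+2}`
  set k := 2 * Fintype.card ι - (d + 2) with hk
  have hk1 : k ≤ Fintype.card ι := by omega
  have hk2 : 2 * Fintype.card ι - k = d + 2 := by omega
  have hm : Fintype.card ι - k = (Fintype.card ι - k - 1) + 1 := by omega
  have := (hardLefschetz_bijOn hc hk1).surjOn
  rw [hk2] at this
  obtain ⟨x, hx, hxy⟩ := this hy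
  refine ⟨theta c ^ (Fintype.card ι - k - 1) * x, ?_, ?_⟩
  · rw [SetLike.mem_coe]
    have h1 : theta c ^ (Fintype.card ι - k - 1) ∈ grading ι (2 * (Fintype.card ι - k - 1)) := by
      have := SetLike.pow_mem_graded (Fintype.card ι - k - 1) (theta_mem_two c)
      simpa [mul_comm] using this
    have h2 := SetLike.mul_mem_graded h1 hx
    convert h2 using 2
    omega
  · simp only at hxy ⊢
    rw [← mul_assoc, ← pow_succ', ← hm, hxy]

/-- (A9)'s `(L^{|ι|−k})^{-1} z`: for `z ∈ ⋀^{2|ι|−k}` the unique `y ∈ ⋀^k` with `θ^{|ι|−k} ∧ y = z`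
(chosen by hard Lefschetz; `lefschetzInv_mem`, `theta_pow_mul_lefschetzInv`, `lefschetzInv_unique`). -/
noncomputable def lefschetzInv (c : ι → ℂ) (hc : ∀ p, c p ≠ 0) {k : ℕ} (hk : k ≤ Fintype.card ι)
    {z : A ι} (hz : z ∈ grading ι (2 * Fintype.card ι - k)) : A ι :=
  Classical.choose ((hardLefschetz_bijOn hc hk).surjOn hz)

/-- `(L^{|ι|−k})^{-1} z ∈ ⋀^k`. -/
theorem lefschetzInv_mem (c : ι → ℂ) (hc : ∀ p, c p ≠ 0) {k : ℕ} (hk : k ≤ Fintype.card ι)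
    {z : A ι} (hz : z ∈ grading ι (2 * Fintype.card ι - k)) :
    lefschetzInv c hc hk hz ∈ grading ι k :=
  (Classical.choose_spec ((hardLefschetz_bijOn hc hk).surjOn hz)).1

/-- `θ^{|ι|−k} ∧ (L^{|ι|−k})^{-1} z = z`. -/
theorem theta_pow_mul_lefschetzInv (c : ι → ℂ) (hc : ∀ p, c p ≠ 0) {k : ℕ}
    (hk : k ≤ Fintype.card ι) {z : A ι} (hz : z ∈ grading ι (2 * Fintype.card ι - k)) :
    theta c ^ (Fintype.card ι - k) * lefschetzInv c hc hk hz = z :=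
  (Classical.choose_spec ((hardLefschetz_bijOn hc hk).surjOn hz)).2

/-- Uniqueness of the Lefschetz preimage in `⋀^k`. -/
theorem lefschetzInv_unique (c : ι → ℂ) (hc : ∀ p, c p ≠ 0) {k : ℕ} (hk : k ≤ Fintype.card ι)
    {z : A ι} (hz : z ∈ grading ι (2 * Fintype.card ι - k)) {y : A ι} (hy : y ∈ grading ι k)
    (hyz : theta c ^ (Fintype.card ι - k) * y = z) : y = lefschetzInv c hc hk hz :=
  (hardLefschetz_bijOn hc hk).injOn hy (lefschetzInv_mem c hc hk hz)
    (by rw [hyz, theta_pow_mul_lefschetzInv])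

end Summit.Ventures.HodgeRepro2.A2HardLefschetzMain
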